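import Summits.CriticalPhenomena.PercolationContinuityZ3.Theorems.Transplant.FKConnectivityAllQPat3ShapeZeroK
import Summits.CriticalPhenomena.PercolationContinuityZ3.Theorems.Transplant.FKConnectivityAllQPat3EeeKClawFreeTsymB
import Summits.CriticalPhenomena.PercolationContinuityZ3.Theorems.Transplant.FKConnectivityAllQPat3EeeKClawFreeStarXB
import Summits.CriticalPhenomena.PercolationContinuityZ3.Theorems.Transplant.FKConnectivityAllQPat3EeeKClawFreeStarXmB
import Summits.CriticalPhenomena.PercolationContinuityZ3.Theorems.Transplant.FKConnectivityAllQPat3EeeKClawFreeStarSB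
import Summits.CriticalPhenomena.PercolationContinuityZ3.Theorems.Transplant.FKConnectivityAllQPat3EeeKClawCdTsymB
import Summits.CriticalPhenomena.PercolationContinuityZ3.Theorems.Transplant.FKConnectivityAllQPat3EeeKClawCdStarXB
import Summits.CriticalPhenomena.PercolationContinuityZ3.Theorems.Transplant.FKConnectivityAllQPat3EeeKClawCdStarXmB
import Summits.CriticalPhenomena.PercolationContinuityZ3.Theorems.Transplant.FKConnectivityAllQPat3EeeKClawCdStarSB
import Summits.CriticalPhenomena.PercolationContinuityZ3.Theorems.Transplant.FKConnectivityAllQPat3EeeKClawBdTsymB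
import Summits.CriticalPhenomena.PercolationContinuityZ3.Theorems.Transplant.FKConnectivityAllQPat3EeeKClawBdStarXB
import Summits.CriticalPhenomena.PercolationContinuityZ3.Theorems.Transplant.FKConnectivityAllQPat3EeeKClawBdStarXmB
import Summits.CriticalPhenomena.PercolationContinuityZ3.Theorems.Transplant.FKConnectivityAllQPat3EeeKClawBdStarSB
import Summits.CriticalPhenomena.PercolationContinuityZ3.Theorems.Transplant.FKConnectivityAllQPat3EeeKClawBdcdTsymB
import Summits.CriticalPhenomena.PercolationContinuityZ3.Theorems.Transplant.FKConnectivityAllQPat3EeeKClawBdcdStarXB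
import Summits.CriticalPhenomena.PercolationContinuityZ3.Theorems.Transplant.FKConnectivityAllQPat3EeeKClawBdcdStarXmB
import Summits.CriticalPhenomena.PercolationContinuityZ3.Theorems.Transplant.FKConnectivityAllQPat3EeeKClawBdcdStarSB
import Summits.CriticalPhenomena.PercolationContinuityZ3.Theorems.Transplant.FKConnectivityAllQPat3EeeKClawBcTsymB
import Summits.CriticalPhenomena.PercolationContinuityZ3.Theorems.Transplant.FKConnectivityAllQPat3EeeKClawBcStarXB
import Summits.CriticalPhenomena.PercolationContinuityZ3.Theorems.Transplant.FKConnectivityAllQPat3EeeKClawBcStarXmB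
import Summits.CriticalPhenomena.PercolationContinuityZ3.Theorems.Transplant.FKConnectivityAllQPat3EeeKClawBcStarSB
import Summits.CriticalPhenomena.PercolationContinuityZ3.Theorems.Transplant.FKConnectivityAllQPat3EeeKClawBccdTsymB
import Summits.CriticalPhenomena.PercolationContinuityZ3.Theorems.Transplant.FKConnectivityAllQPat3EeeKClawBccdStarXB
import Summits.CriticalPhenomena.PercolationContinuityZ3.Theorems.Transplant.FKConnectivityAllQPat3EeeKClawBccdStarXmB
import Summits.CriticalPhenomena.PercolationContinuityZ3.Theorems.Transplant.FKConnectivityAllQPat3EeeKClawBccdStarSB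
import Summits.CriticalPhenomena.PercolationContinuityZ3.Theorems.Transplant.FKConnectivityAllQPat3EeeKClawBcbdTsymB
import Summits.CriticalPhenomena.PercolationContinuityZ3.Theorems.Transplant.FKConnectivityAllQPat3EeeKClawBcbdStarXB
import Summits.CriticalPhenomena.PercolationContinuityZ3.Theorems.Transplant.FKConnectivityAllQPat3EeeKClawBcbdStarXmB
import Summits.CriticalPhenomena.PercolationContinuityZ3.Theorems.Transplant.FKConnectivityAllQPat3EeeKClawBcbdStarSB
import Summits.CriticalPhenomena.PercolationContinuityZ3.Theorems.Transplant.FKConnectivityAllQPat3EeeKClawBcbdcdTsymB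
import Summits.CriticalPhenomena.PercolationContinuityZ3.Theorems.Transplant.FKConnectivityAllQPat3EeeKClawBcbdcdStarXB
import Summits.CriticalPhenomena.PercolationContinuityZ3.Theorems.Transplant.FKConnectivityAllQPat3EeeKClawBcbdcdStarXmB
import Summits.CriticalPhenomena.PercolationContinuityZ3.Theorems.Transplant.FKConnectivityAllQPat3EeeKClawBcbdcdStarSB
import HarnessLib

/-!
# Connectivity correlation inequalities for `φ_{w,q}`, every `q > 0` — THE LEAF EEEclaw IN ALL EIGHT K-STATES: the row facts bundled over
# the splits of `[(1, 2), (1, 3), (2, 3)]` (census g41)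

Proof file (`--supports stmt-CriticalPhenomena-4575`), census lineage (gen 41) of LANE 2's FK sub-programme; builds on p205010 (kernel
theorem, internal audit signed; external expert review pending).  No definitions, no named facts, no sorries; standard axioms.

Collects the closing `_rows` theorems of the 32 data file groups `…Pat3EeeKClaw<State><Target>…` (8 states × 4 targets; census g41's prepared
set, kit j242142 certificates, `coefTab3K`) into four statements quantified over the state (L, K) of the three plain slots:
`FK.eeeKclaw_tsym_rows / _starX_rows / _starXm_rows / _starS_rows` — the form the K-state leaf lemmas `…Pat3EeeLeafK` consume.
[cite: AyyerLinussonRavichandran2025, §7 (p. 22)]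
-/

namespace Summit.CriticalPhenomena.PercolationContinuityZ3.Theorems

namespace FK

/-- The 8 ordered splits of the plain slots `[(1, 2), (1, 3), (2, 3)]` into (free, contracted), in the order `FK.splits` lists them. [folklore] -/
theorem splits_eeeclawSkelK : splits ([(1, 2), (1, 3), (2, 3)] : List (Fin 7 × Fin 7)) =
    [([(1, 2), (1, 3), (2, 3)], []),
     ([(1, 2), (1, 3)], [(2, 3)]),
     ([(1, 2), (2, 3)], [(1, 3)]),
     ([(1, 2)], [(1, 3), (2, 3)]),
     ([(1, 3), (2, 3)], [(1, 2)]),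
     ([(1, 3)], [(1, 2), (2, 3)]),
     ([(2, 3)], [(1, 2), (1, 3)]),
     ([], [(1, 2), (1, 3), (2, 3)])] := by
  decide

/-- **EEEclaw rows in every K-state, target `tsym2Tab`** (kernel-checked certificates of the 8 data file groups). [cite: AyyerLinussonRavichandran2025, §7 (p. 22)] -/
theorem eeeKclaw_tsym_rows : ∀ LK ∈ splits ([(1, 2), (1, 3), (2, 3)] : List (Fin 7 × Fin 7)), ∃ prods : List Prod3, ∃ Dn : ℕ, 0 < Dn ∧
    (∃ cs : List (ℕ × ℕ × ℕ × ℕ × ℕ), prods = cs.map (Prod3.ofIdx famP11orb)) ∧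
    ∀ (d : ℕ) (PK QK P1 Q1 P2 Q2 : Pat3), 8 * (prods.map fun q => (q.lam : ℤ) * q.tensor d PK QK P1 Q1 P2 Q2).sum ≤
      (Dn : ℤ) * symm8d (coefTab3K LK.1 LK.2 (0 : Fin 7) 1 4 0 2 5 0 3 6 4 5 6 tsym2Tab) d PK QK P1 Q1 P2 Q2 := by
  intro LK hLK
  rw [splits_eeeclawSkelK] at hLK
  fin_cases hLK

  · exact ⟨eeeKclawfree_tsymProds, 4496171520, by decide, ⟨_, rfl⟩, eeeKclawfree_tsym_rows⟩
  · exact ⟨eeeKclawcd_tsymProds, 64, by decide, ⟨_, rfl⟩, eeeKclawcd_tsym_rows⟩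
  · exact ⟨eeeKclawbd_tsymProds, 64, by decide, ⟨_, rfl⟩, eeeKclawbd_tsym_rows⟩
  · exact ⟨eeeKclawbdcd_tsymProds, 8, by decide, ⟨_, rfl⟩, eeeKclawbdcd_tsym_rows⟩
  · exact ⟨eeeKclawbc_tsymProds, 64, by decide, ⟨_, rfl⟩, eeeKclawbc_tsym_rows⟩
  · exact ⟨eeeKclawbccd_tsymProds, 8, by decide, ⟨_, rfl⟩, eeeKclawbccd_tsym_rows⟩
  · exact ⟨eeeKclawbcbd_tsymProds, 8, by decide, ⟨_, rfl⟩, eeeKclawbcbd_tsym_rows⟩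
  · exact ⟨eeeKclawbcbdcd_tsymProds, 16, by decide, ⟨_, rfl⟩, eeeKclawbcbdcd_tsym_rows⟩

/-- **EEEclaw rows in every K-state, target `starXTab`** (kernel-checked certificates of the 8 data file groups). [cite: AyyerLinussonRavichandran2025, §7 (p. 22)] -/
theorem eeeKclaw_starX_rows : ∀ LK ∈ splits ([(1, 2), (1, 3), (2, 3)] : List (Fin 7 × Fin 7)), ∃ prods : List Prod3, ∃ Dn : ℕ, 0 < Dn ∧
    (∃ cs : List (ℕ × ℕ × ℕ × ℕ × ℕ), prods = cs.map (Prod3.ofIdx famP11orb)) ∧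
    ∀ (d : ℕ) (PK QK P1 Q1 P2 Q2 : Pat3), 8 * (prods.map fun q => (q.lam : ℤ) * q.tensor d PK QK P1 Q1 P2 Q2).sum ≤
      (Dn : ℤ) * symm8d (coefTab3K LK.1 LK.2 (0 : Fin 7) 1 4 0 2 5 0 3 6 4 5 6 starXTab) d PK QK P1 Q1 P2 Q2 := by
  intro LK hLK
  rw [splits_eeeclawSkelK] at hLK
  fin_cases hLK

  · exact ⟨eeeKclawfree_starXProds, 93182293440, by decide, ⟨_, rfl⟩, eeeKclawfree_starX_rows⟩
  · exact ⟨eeeKclawcd_starXProds, 800, by decide, ⟨_, rfl⟩, eeeKclawcd_starX_rows⟩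
  · exact ⟨eeeKclawbd_starXProds, 59496672, by decide, ⟨_, rfl⟩, eeeKclawbd_starX_rows⟩
  · exact ⟨eeeKclawbdcd_starXProds, 944, by decide, ⟨_, rfl⟩, eeeKclawbdcd_starX_rows⟩
  · exact ⟨eeeKclawbc_starXProds, 2014656, by decide, ⟨_, rfl⟩, eeeKclawbc_starX_rows⟩
  · exact ⟨eeeKclawbccd_starXProds, 944, by decide, ⟨_, rfl⟩, eeeKclawbccd_starX_rows⟩
  · exact ⟨eeeKclawbcbd_starXProds, 944, by decide, ⟨_, rfl⟩, eeeKclawbcbd_starX_rows⟩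
  · exact ⟨eeeKclawbcbdcd_starXProds, 1888, by decide, ⟨_, rfl⟩, eeeKclawbcbdcd_starX_rows⟩

/-- **EEEclaw rows in every K-state, target `mirror2 starXTab`** (kernel-checked certificates of the 8 data file groups). [cite: AyyerLinussonRavichandran2025, §7 (p. 22)] -/
theorem eeeKclaw_starXm_rows : ∀ LK ∈ splits ([(1, 2), (1, 3), (2, 3)] : List (Fin 7 × Fin 7)), ∃ prods : List Prod3, ∃ Dn : ℕ, 0 < Dn ∧
    (∃ cs : List (ℕ × ℕ × ℕ × ℕ × ℕ), prods = cs.map (Prod3.ofIdx famP11orb)) ∧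
    ∀ (d : ℕ) (PK QK P1 Q1 P2 Q2 : Pat3), 8 * (prods.map fun q => (q.lam : ℤ) * q.tensor d PK QK P1 Q1 P2 Q2).sum ≤
      (Dn : ℤ) * symm8d (coefTab3K LK.1 LK.2 (0 : Fin 7) 1 4 0 2 5 0 3 6 4 5 6 (mirror2 starXTab)) d PK QK P1 Q1 P2 Q2 := by
  intro LK hLK
  rw [splits_eeeclawSkelK] at hLK
  fin_cases hLK

  · exact ⟨eeeKclawfree_starXmProds, 214319274912, by decide, ⟨_, rfl⟩, eeeKclawfree_starXm_rows⟩
  · exact ⟨eeeKclawcd_starXmProds, 217787136, by decide, ⟨_, rfl⟩, eeeKclawcd_starXm_rows⟩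
  · exact ⟨eeeKclawbd_starXmProds, 800, by decide, ⟨_, rfl⟩, eeeKclawbd_starXm_rows⟩
  · exact ⟨eeeKclawbdcd_starXmProds, 6608, by decide, ⟨_, rfl⟩, eeeKclawbdcd_starXm_rows⟩
  · exact ⟨eeeKclawbc_starXmProds, 79018016, by decide, ⟨_, rfl⟩, eeeKclawbc_starXm_rows⟩
  · exact ⟨eeeKclawbccd_starXmProds, 6608, by decide, ⟨_, rfl⟩, eeeKclawbccd_starXm_rows⟩
  · exact ⟨eeeKclawbcbd_starXmProds, 6608, by decide, ⟨_, rfl⟩, eeeKclawbcbd_starXm_rows⟩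
  · exact ⟨eeeKclawbcbdcd_starXmProds, 13216, by decide, ⟨_, rfl⟩, eeeKclawbcbdcd_starXm_rows⟩

/-- **EEEclaw rows in every K-state, target `starSTab`** (kernel-checked certificates of the 8 data file groups). [cite: AyyerLinussonRavichandran2025, §7 (p. 22)] -/
theorem eeeKclaw_starS_rows : ∀ LK ∈ splits ([(1, 2), (1, 3), (2, 3)] : List (Fin 7 × Fin 7)), ∃ prods : List Prod3, ∃ Dn : ℕ, 0 < Dn ∧
    (∃ cs : List (ℕ × ℕ × ℕ × ℕ × ℕ), prods = cs.map (Prod3.ofIdx famP11orb)) ∧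
    ∀ (d : ℕ) (PK QK P1 Q1 P2 Q2 : Pat3), 8 * (prods.map fun q => (q.lam : ℤ) * q.tensor d PK QK P1 Q1 P2 Q2).sum ≤
      (Dn : ℤ) * symm8d (coefTab3K LK.1 LK.2 (0 : Fin 7) 1 4 0 2 5 0 3 6 4 5 6 starSTab) d PK QK P1 Q1 P2 Q2 := by
  intro LK hLK
  rw [splits_eeeclawSkelK] at hLK
  fin_cases hLK

  · exact ⟨eeeKclawfree_starSProds, 214319274912, by decide, ⟨_, rfl⟩, eeeKclawfree_starS_rows⟩
  · exact ⟨eeeKclawcd_starSProds, 2036448, by decide, ⟨_, rfl⟩, eeeKclawcd_starS_rows⟩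
  · exact ⟨eeeKclawbd_starSProds, 506384288, by decide, ⟨_, rfl⟩, eeeKclawbd_starS_rows⟩
  · exact ⟨eeeKclawbdcd_starSProds, 944, by decide, ⟨_, rfl⟩, eeeKclawbdcd_starS_rows⟩
  · exact ⟨eeeKclawbc_starSProds, 800, by decide, ⟨_, rfl⟩, eeeKclawbc_starS_rows⟩
  · exact ⟨eeeKclawbccd_starSProds, 944, by decide, ⟨_, rfl⟩, eeeKclawbccd_starS_rows⟩
  · exact ⟨eeeKclawbcbd_starSProds, 944, by decide, ⟨_, rfl⟩, eeeKclawbcbd_starS_rows⟩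
  · exact ⟨eeeKclawbcbdcd_starSProds, 1888, by decide, ⟨_, rfl⟩, eeeKclawbcbdcd_starS_rows⟩

end FK

end Summit.CriticalPhenomena.PercolationContinuityZ3.Theorems
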